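import Summits.Parity.GeneralizedHardyLittlewood.Theses.ParityWeightedChenSwitching
import Summits.Parity.GeneralizedHardyLittlewood.Theses.LiouvilleShiftedTables
import HarnessLib

/-!
# Crux `TwinLowerDensityToGHL` (stmt-Parity-18665; route `ParityWeightedChenSwitching`, rank 4, declared RESIDUAL)
# — BIRTH SKELETON `Lines/birth.lean` (skeleton registrar `skel-stmt-Parity-18665`, 2026-08-17)

Target, BY NAME: `Summit.Parity.GeneralizedHardyLittlewood.Theses.ParityWeightedChenSwitching.TwinLowerDensityToGHL`,
literally `R := T → GeneralizedHardyLittlewood` with `T` the route's support node `TwinLowerDensity`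
(`∃ c > 0, ∃ x₀, ∀ x ≥ x₀, c·x/log²x ≤ π₂(x)`).

The skeleton is the route header's own two-layer plan for `R` ("R ⇐ (TwinLowerDensity → PairsHL) → PairsToGHL,
both GHL-hard, recorded only"), typed so that the hypothesis `T` is LOAD-BEARING in the composition (the refuter's
birth note on the earlier, unpublished skeleton `PairsHL, PairsToGHL ⊢ R` was "T decoration"; that pair of stubs is
jointly the summit, `PairsToGHL ∧ PairsHL ↔ DimOne ↔ GHL`, tree
`Theorems.PairsToGHL.pairsToGHL_and_pairsHL_iff_dimOne` + `DicksonFibration.Assembly_holds`):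

* `stub_pairsHL_of_twinLowerDensity` — **BOOTSTRAP** `T → PairsHL`: a positive lower density of twin primes upgrades to
  the Hardy–Littlewood pair asymptotic `∑_{n ≤ N} Λ(n)Λ(n+h) = 𝔖({0,h}) N + o(N)` at EVERY shift `h ≥ 1`
  (hypothesis = `ParityWeightedChenSwitching.TwinLowerDensity` verbatim, conclusion = `LiouvilleShiftedTables.PairsHL`
  (stmt-Parity-9387) verbatim). This is exactly the converse gap of the landed domination theorem
  `Theorems.TwinLowerDensityToGHL.Negative.not_twinLowerDensityToGHL_of_not_pairsToGHL` (`R → PairsToGHL`); it is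
  implied by `R` (via `Theorems.PairsToGHL.pairAsymptotic_of_generalizedHardyLittlewood`) and by the summit, and it
  does not give `R` or the summit on its own (needs `PairsToGHL`). Open (contains Hardy–Littlewood pairs modulo `T`).
* `stub_pairsToGHL` — **THE SHARED RESIDUAL** `PairsHL → GeneralizedHardyLittlewood`, verbatim the signature of item
  stmt-Parity-9389 `LiouvilleShiftedTables.PairsToGHL` (shared by LiouvilleShiftedTables / RoughSemiprimeRigidity /
  LiouvilleMAD / HullDial; `↔ EngineToGHL` stmt-Parity-14995; unconditionally `↔ (PairsHL → DicksonFibration.DimOne)`,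
  `Theorems.PairsToGHLReduction.pairsToGHL_iff_pairsHL_imp_dimOne`; live line `Cruxes/PairsToGHL/Lines/sloped_ladder.lean`).
  It does not give `R` or the summit on its own (needs `T → PairsHL`, resp. `PairsHL`).

EXACTNESS (proved sorry-free in the registrar's scratch file `bc/birth_sanity.lean`, not here):
`R ↔ (stub₁-statement ∧ stub₂-statement)` over the landed theorems named above — the two stubs are jointly THE CRUX,
not the summit. Sorries live only in the two `stub_*`; `TwinLowerDensityToGHL_of` is the kernel-checked composition and
`TwinLowerDensityToGHL_proof` concludes the crux by name from the stubs.
-/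

namespace Summit.Parity.GeneralizedHardyLittlewood.Cruxes.TwinLowerDensityToGHL.Birth

open scoped BigOperators

/-! ## Registered stubs (the ONLY sorries of this file) -/

/-- Registered stub 1 — **BOOTSTRAP `T → PairsHL`** (open; GHL-hard modulo `T`): if twin primes have positive lower
density on the Hardy–Littlewood scale, then for every shift `h ≥ 1`,
`∑_{n ≤ N} Λ(n)Λ(n+h) − 𝔖({0,h})·N = o(N)`. Hypothesis = `ParityWeightedChenSwitching.TwinLowerDensity`,
conclusion = `LiouvilleShiftedTables.PairsHL`, both verbatim (`Iff.rfl`). [folklore] -/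
theorem stub_pairsHL_of_twinLowerDensity :
    (∃ c : ℝ, 0 < c ∧ ∃ x₀ : ℕ, ∀ x : ℕ, x₀ ≤ x → c * (x : ℝ) / Real.log x ^ 2 ≤ (((Finset.range (x + 1)).filter (fun p => p.Prime ∧ (p + 2).Prime)).card : ℝ)) → ∀ h : ℕ, 1 ≤ h → (fun N : ℕ => ∑ n ∈ Finset.Icc 1 N, ArithmeticFunction.vonMangoldt n * ArithmeticFunction.vonMangoldt (n + h) - Literature.NumberTheory.Sieve.singularSeries ({0, (h : ℤ)} : Finset ℤ) * N) =o[Filter.atTop] fun N : ℕ => (N : ℝ) := by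
  sorry

/-- Registered stub 2 — **THE SHARED RESIDUAL `PairsToGHL`** (open; verbatim item stmt-Parity-9389
`LiouvilleShiftedTables.PairsToGHL`): the Hardy–Littlewood pair asymptotics at every shift imply Green–Tao's
Conjecture 1.2 at all complexities. [folklore] -/
theorem stub_pairsToGHL :
    (∀ h : ℕ, 1 ≤ h → (fun N : ℕ => ∑ n ∈ Finset.Icc 1 N, ArithmeticFunction.vonMangoldt n * ArithmeticFunction.vonMangoldt (n + h) - Literature.NumberTheory.Sieve.singularSeries ({0, (h : ℤ)} : Finset ℤ) * N) =o[Filter.atTop] fun N : ℕ => (N : ℝ)) → _root_.GeneralizedHardyLittlewood := by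
  sorry

/-! ## The composition: the stubs imply the crux, by name (no sorry below this line) -/

/-- **THE SKELETON THEOREM.** `(T → PairsHL) → (PairsHL → GHL) → TwinLowerDensityToGHL`: given `T`, bootstrap to
`PairsHL`, then apply the shared residual; `T` is consumed. [folklore] -/
theorem TwinLowerDensityToGHL_of :
    ((∃ c : ℝ, 0 < c ∧ ∃ x₀ : ℕ, ∀ x : ℕ, x₀ ≤ x → c * (x : ℝ) / Real.log x ^ 2 ≤ (((Finset.range (x + 1)).filter (fun p => p.Prime ∧ (p + 2).Prime)).card : ℝ)) → ∀ h : ℕ, 1 ≤ h → (fun N : ℕ => ∑ n ∈ Finset.Icc 1 N, ArithmeticFunction.vonMangoldt n * ArithmeticFunction.vonMangoldt (n + h) - Literature.NumberTheory.Sieve.singularSeries ({0, (h : ℤ)} : Finset ℤ) * N) =o[Filter.atTop] fun N : ℕ => (N : ℝ)) →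
    ((∀ h : ℕ, 1 ≤ h → (fun N : ℕ => ∑ n ∈ Finset.Icc 1 N, ArithmeticFunction.vonMangoldt n * ArithmeticFunction.vonMangoldt (n + h) - Literature.NumberTheory.Sieve.singularSeries ({0, (h : ℤ)} : Finset ℤ) * N) =o[Filter.atTop] fun N : ℕ => (N : ℝ)) → _root_.GeneralizedHardyLittlewood) →
    Summit.Parity.GeneralizedHardyLittlewood.Theses.ParityWeightedChenSwitching.TwinLowerDensityToGHL :=
  fun h₁ h₂ hT => h₂ (h₁ hT)

/-- The skeleton in its final shape: the crux BY NAME from the two registered stubs (depends on `sorryAx` only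
through `stub_pairsHL_of_twinLowerDensity` and `stub_pairsToGHL`). [folklore] -/
theorem TwinLowerDensityToGHL_proof :
    Summit.Parity.GeneralizedHardyLittlewood.Theses.ParityWeightedChenSwitching.TwinLowerDensityToGHL :=
  TwinLowerDensityToGHL_of stub_pairsHL_of_twinLowerDensity stub_pairsToGHL

end Summit.Parity.GeneralizedHardyLittlewood.Cruxes.TwinLowerDensityToGHL.Birth
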